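import Literature.NumberTheory.Transcendental.RoySmallValueEstimatesEndgameAssemblyProofs
import HarnessLib

/-!
# Route `RoyCriterion`, crux `NguyenRoySmallValueTranslates` (stmt-Schanuel-1051), line `Sketch`
# — helper lemmas for the stub `stub_concentratedCloses`

Helper lemmas for the registered stub A (`stub_concentratedCloses`, file
`RoyCriterionNguyenRoySmallValueTranslatesStubConcentratedCloses.lean`) of the skeleton of line
`Sketch` for the crux `Summit.Schanuel.Schanuel.Theses.RoyCriterion.NguyenRoySmallValueTranslates`,
over an abstract `NguyenRoy.EndgameData σ β ν` (the data entering §6 of Nguyen–Roy 2016):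

* `concCase_eventually` — the numerics of the concentrated case (`D` large);
* `recentre_bounds` — Lemmas 5 and 11 at the recentring `Z' = τ^{−m} Z_D` of a concentrated
  point `a₀ ∈ Z_D` (`log dist(τ^{−m} a₀, γ₀) ≤ c₁D^σ − D^β − R`, `h(Z') ≤ h(Z_D) + c₄D^σ deg`);
* `concCase_core` — the polynomial argument of §6, Case 2, for the recentred class at its
  auxiliary level `d ≤ D`: the values `v` of the polynomial of `notIn` on `τ^{T*−1} Z'`
  (`T* = ⌊d^σ⌋`) are bounded below in the mean and above pointwise ((6.5) with `k = T* − 1`);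
  sub-case (i) contradicts `case2i_eventually`, sub-case (ii) the concentration inequality.

Proofs only; everything follows `EndgameData.case2_core` of the tree.

## References

* [NguyenRoy2016] N. A. V. Nguyen, D. Roy, IJNT 12 (2016) 1273–1293 = arXiv:1412.5163, §6
  (Case 2, (6.1)–(6.6)), Proposition 14, Lemmas 5 and 11.
-/

-- `Summit.Schanuel.Schanuel.…` is the mandated layout of this single-problem summit (CONVENTIONS §1).
set_option linter.dupNamespace false

noncomputable section

open Filter Finset
open scoped Classical

namespace Summit.Schanuel.Schanuel.Theorems.NguyenRoySharp

open Literature.NumberTheory.Transcendental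
open Literature.NumberTheory.Transcendental.NguyenRoy

section Abstract

variable {σ β ν : ℝ} (E : EndgameData σ β ν)

/-- Numerics of the concentrated case: `1 ≤ (κ/2) D^{ν−β+σ−2}` and
`log 2 + log 3 + 5D^β + c₁D^σ + c₇D + 2c₄D^{1+σ} < κ D^{ν+σ−2}` for `D` large (every exponent
on the left is `< ν + σ − 2` since `ν > 2 + β − σ`, `β > σ + 1 ≥ 2`).
[cite: NguyenRoy2016, §6, Case 2] -/
theorem concCase_eventually {κ c₁ c₇ c₄ : ℝ} (hκ : 0 < κ) (hσ1 : 1 ≤ σ)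
    (hβ : σ + 1 < β) (hν : 2 + β - σ < ν) :
    ∀ᶠ D : ℕ in atTop, 1 ≤ κ / 2 * (D : ℝ) ^ (ν - β + σ - 2) ∧
      Real.log 2 + Real.log 3 + 5 * (D : ℝ) ^ β + c₁ * (D : ℝ) ^ σ + c₇ * D +
        2 * c₄ * (D : ℝ) ^ (1 + σ) < κ * (D : ℝ) ^ (ν + σ - 2) := by
  have e0 := EndgameData.eventually_mul_rpow_le_rpow (2 / κ) (a := 0) (b := ν - β + σ - 2)
    (by linarith)
  have e1 := EndgameData.eventually_mul_rpow_le_rpow (6 / κ * (Real.log 2 + Real.log 3))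
    (a := 0) (b := ν + σ - 2) (by linarith)
  have e2 := EndgameData.eventually_mul_rpow_le_rpow (6 / κ * 5) (a := β) (b := ν + σ - 2)
    (by linarith)
  have e3 := EndgameData.eventually_mul_rpow_le_rpow (6 / κ * c₁) (a := σ) (b := ν + σ - 2)
    (by linarith)
  have e4 := EndgameData.eventually_mul_rpow_le_rpow (6 / κ * c₇) (a := 1) (b := ν + σ - 2)
    (by linarith)
  have e5 := EndgameData.eventually_mul_rpow_le_rpow (6 / κ * (2 * c₄)) (a := 1 + σ)
    (b := ν + σ - 2) (by linarith)
  filter_upwards [e0, e1, e2, e3, e4, e5, eventually_ge_atTop 1] with D h0 h1 h2 h3 h4 h5 hD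
  have hDpos : (0 : ℝ) < D := by exact_mod_cast hD
  have hpow : 0 < κ * (D : ℝ) ^ (ν + σ - 2) := mul_pos hκ (Real.rpow_pos_of_pos hDpos _)
  rw [Real.rpow_zero, mul_one] at h0 h1
  rw [Real.rpow_one] at h4
  have hk : 0 < 6 / κ := by positivity
  have hq : (D : ℝ) ^ (ν + σ - 2) / (6 / κ) = κ / 6 * (D : ℝ) ^ (ν + σ - 2) := by
    rw [div_div_eq_mul_div]; ring
  have g : ∀ y : ℝ, 6 / κ * y ≤ (D : ℝ) ^ (ν + σ - 2) → y ≤ κ / 6 * (D : ℝ) ^ (ν + σ - 2) := by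
    intro y hy
    rw [← hq]
    exact (le_div_iff₀' hk).mpr hy
  have g1 := g _ h1
  have g2 := g _ (by rw [← mul_assoc]; exact h2)
  have g3 := g _ (by rw [← mul_assoc]; exact h3)
  have g4 := g _ (by rw [← mul_assoc]; exact h4)
  have g5 := g _ (by rw [← mul_assoc]; exact h5)
  constructor
  · have h6 : κ / 2 * (2 / κ) = 1 := by field_simp
    have h7 := mul_le_mul_of_nonneg_left h0 (by positivity : (0 : ℝ) ≤ κ / 2)
    linarith
  · linarith

/-- **Recentring at the concentrated point** (Lemmas 5 and 11): if `a₀ ∈ Z_D` and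
`D^β + log dist(a₀, γ_m) ≤ −R` with `0 ≤ m < ⌊D^σ⌋`, then `a₀' = τ^{−m} a₀` satisfies
`log dist(a₀', γ₀) ≤ c₁D^σ − D^β − R`, and `h(τ^{−m} Z_D) ≤ h(Z_D) + c₄ D^σ deg Z_D`.
[cite: NguyenRoy2016, Lemma 5, Lemma 11] -/
theorem recentre_bounds {D m : ℕ} {a₀ : E.Pt} {R : ℝ} (hm : m < ⌊(D : ℝ) ^ σ⌋₊)
    (ha₀ : a₀ ∈ E.pts (E.Z D))
    (hle : (D : ℝ) ^ β + Real.log (E.dist a₀ (E.γ m)) ≤ -R) :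
    Real.log (E.dist (E.τ (-(m : ℤ)) a₀) (E.γ 0)) ≤ E.c₁ * (D : ℝ) ^ σ - (D : ℝ) ^ β - R ∧
      E.ht (E.τV (-(m : ℤ)) (E.Z D)) ≤
        E.ht (E.Z D) + E.c₄ * (D : ℝ) ^ σ * (E.pts (E.Z D)).card := by
  have hmσ : (m : ℝ) ≤ (D : ℝ) ^ σ :=
    le_trans (by exact_mod_cast hm.le) (Nat.floor_le (by positivity))
  have habs : |((-(m : ℤ) : ℤ) : ℝ)| = m := by
    push_cast
    rw [abs_neg, abs_of_nonneg (Nat.cast_nonneg _)]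
  constructor
  · have hγ : E.τ (-(m : ℤ)) (E.γ m) = E.γ 0 := by rw [E.τ_γ, neg_add_cancel]
    have hpos : 0 < E.dist a₀ (E.γ m) := E.dist_γ_pos _ _ ha₀ _
    have hpos' : 0 < E.dist (E.τ (-(m : ℤ)) a₀) (E.γ 0) :=
      E.dist_γ_pos _ _ (E.τ_mem_pts_τV _ _ ha₀) 0
    have h1 : E.dist (E.τ (-(m : ℤ)) a₀) (E.γ 0) ≤
        Real.exp (E.c₁ * m) * E.dist a₀ (E.γ m) := by
      have h := E.dist_τ_le (-(m : ℤ)) a₀ (E.γ m)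
      rwa [hγ, habs] at h
    have h2 := Real.log_le_log hpos' h1
    rw [Real.log_mul (Real.exp_pos _).ne' hpos.ne', Real.log_exp] at h2
    have h3 : E.c₁ * m ≤ E.c₁ * (D : ℝ) ^ σ := mul_le_mul_of_nonneg_left hmσ E.c₁_nonneg
    linarith
  · have h := E.ht_τV_le (-(m : ℤ)) (E.Z D)
    rw [habs] at h
    have : E.c₄ * (m : ℝ) * (E.pts (E.Z D)).card ≤ E.c₄ * (D : ℝ) ^ σ * (E.pts (E.Z D)).card :=
      mul_le_mul_of_nonneg_right (mul_le_mul_of_nonneg_left hmσ E.c₄_nonneg) (by positivity)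
    linarith

/-- **The concentrated case at one level** (the polynomial argument of §6, Case 2, for the
recentred class `Z'` at its auxiliary level `d ≤ D`): `Z'' = τ^{T*−1} Z' ⊄ W_d` (`T* = ⌊d^σ⌋`,
`not_isIn_of_crit`), so the values `v` of the polynomial of `notIn` satisfy
`∑ log v ≥ −(c₇ d deg + d h(Z''))` and `v(τ^{T*−1} b) ≤ e^{−d^ν/2} + e^{3d^β} dist(b, γ₀)` for
`b ∈ Z'` ((6.5) with `k = T* − 1`, Lemma 5); if `e^{3d^β} dist(a₀', γ₀) ≤ e^{−d^ν/2}` this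
contradicts `case2i_eventually` (hypothesis `hN₂`), otherwise the concentration inequality
`hclose` for `D` large (hypotheses `hT1`, `hT2`). [cite: NguyenRoy2016, §6, Case 2] -/
theorem concCase_core (hσ1 : 1 ≤ σ) (hβ : σ + 1 < β)
    {D d : ℕ} {Zt : E.V} {a₀ : E.Pt} {h : ℝ} (hd1 : 1 ≤ d) (hdD : d ≤ D) (hd0 : E.D₀ ≤ d)
    (hN₂ : ∀ deg h : ℝ, 0 ≤ deg → deg ≤ 2 * E.A₁₄ * (d : ℝ) ^ (2 - σ) → 0 ≤ h →
      h ≤ 2 * E.B₁₄ * (d : ℝ) ^ (1 + β - σ) →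
      Real.log 2 + deg * (Real.log 3 + 3 * (d : ℝ) ^ β + E.c₇ * d + E.c₄ * (d : ℝ) ^ (1 + σ)) +
        d * h < (d : ℝ) ^ ν / 2)
    (hN₄ : ((d : ℝ) + 2) ^ 3 * Real.exp (2 * (d : ℝ) ^ β) * Real.exp (E.c₁ * (d : ℝ) ^ σ)
      ≤ Real.exp (3 * (d : ℝ) ^ β))
    (hT1 : 1 ≤ E.κ / 2 * (D : ℝ) ^ (ν - β + σ - 2))
    (hT2 : Real.log 2 + Real.log 3 + 5 * (D : ℝ) ^ β + E.c₁ * (D : ℝ) ^ σ + E.c₇ * D +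
      2 * E.c₄ * (D : ℝ) ^ (1 + σ) < E.κ * (D : ℝ) ^ (ν + σ - 2))
    (hcrit : E.A₁₄ * (d : ℝ) ^ (2 - σ) < (E.pts Zt).card ∨
      E.B₁₄ * (d : ℝ) ^ (1 + β - σ) < E.ht Zt)
    (hdeg : ((E.pts Zt).card : ℝ) ≤ 2 * E.A₁₄ * (d : ℝ) ^ (2 - σ))
    (hht : E.ht Zt ≤ 2 * E.B₁₄ * (d : ℝ) ^ (1 + β - σ))
    (hh0 : 0 ≤ h) (hhtZ : E.ht Zt ≤ h + E.c₄ * (D : ℝ) ^ σ * (E.pts Zt).card)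
    (ha₀ : a₀ ∈ E.pts Zt)
    (hclose : Real.log (E.dist a₀ (E.γ 0)) ≤ E.c₁ * (D : ℝ) ^ σ - (D : ℝ) ^ β -
      E.κ / 2 * (D : ℝ) ^ (ν - β + σ - 2) * (2 * (D : ℝ) ^ β * (E.pts Zt).card + D * h)) :
    False := by
  have hκ := E.κ_pos
  have hdpos : (0 : ℝ) < d := by exact_mod_cast hd1
  have hdr : (1 : ℝ) ≤ d := by exact_mod_cast hd1
  have hdD' : (d : ℝ) ≤ D := by exact_mod_cast hdD
  have hDpos : (0 : ℝ) < D := by linarith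
  have hcard1 : (1 : ℝ) ≤ (E.pts Zt).card := E.one_le_card _
  set c : ℝ := ((E.pts Zt).card : ℝ) with hc_def
  set T : ℕ := ⌊(d : ℝ) ^ σ⌋₊ with hT
  have h1σ : (1 : ℝ) ≤ (d : ℝ) ^ σ := Real.one_le_rpow hdr (by linarith)
  have h1T : 1 ≤ T := Nat.le_floor (by exact_mod_cast h1σ)
  have hTσ : (T : ℝ) ≤ (d : ℝ) ^ σ := Nat.floor_le (by positivity)
  have hT1r : (0 : ℝ) ≤ (T : ℝ) - 1 := by
    have : (1 : ℝ) ≤ T := by exact_mod_cast h1T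
    linarith
  have habsT : |(((T : ℤ) - 1 : ℤ) : ℝ)| = (T : ℝ) - 1 := by
    push_cast; exact abs_of_nonneg hT1r
  -- `Z'' := τ^{T-1} Z' ⊄ W_d` and its polynomial
  have hnot : ¬ E.IsIn (E.τV ((T : ℤ) - 1) Zt) d := by
    refine E.not_isIn_of_crit hd0 hcrit ?_
    rw [habsT]
    have : (0 : ℝ) ≤ T := by positivity
    linarith
  obtain ⟨j, hj0, hj2, v, hvpos, hL, hU⟩ := E.notIn d hd0 _ hnot
  have hcardZ : (E.pts (E.τV ((T : ℤ) - 1) Zt)).card = (E.pts Zt).card := E.card_pts_τV _ _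
  have hhtZ' : E.ht (E.τV ((T : ℤ) - 1) Zt) ≤ E.ht Zt + E.c₄ * (d : ℝ) ^ σ * c := by
    have h' := E.ht_τV_le ((T : ℤ) - 1) Zt
    rw [habsT] at h'
    have : E.c₄ * ((T : ℝ) - 1) * c ≤ E.c₄ * (d : ℝ) ^ σ * c := by
      apply mul_le_mul_of_nonneg_right _ (by positivity)
      exact mul_le_mul_of_nonneg_left (by linarith) E.c₄_nonneg
    linarith
  rw [hcardZ, E.sum_pts_τV] at hL
  have hvpos' : ∀ b ∈ E.pts Zt, 0 < v (E.τ ((T : ℤ) - 1) b) := fun b hb =>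
    hvpos _ (E.τ_mem_pts_τV _ _ hb)
  -- the pointwise upper bound (6.5) with `k = T - 1`, and Lemma 5
  have hU' : ∀ b ∈ E.pts Zt, v (E.τ ((T : ℤ) - 1) b) ≤
      Real.exp (-(d : ℝ) ^ ν / 2) + Real.exp (3 * (d : ℝ) ^ β) * E.dist b (E.γ 0) := by
    intro b hb
    have hbZ : E.τ ((T : ℤ) - 1) b ∈ E.pts (E.τV ((T : ℤ) - 1) Zt) := E.τ_mem_pts_τV _ _ hb
    have hk0 : 0 ≤ j + ((T : ℤ) - 1) := by omega
    have hk4 : j + ((T : ℤ) - 1) < 4 * (T : ℕ) := by omega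
    have hu := hU _ hbZ ((T : ℤ) - 1) hk0 hk4
    have hγ : E.γ ((T : ℤ) - 1) = E.τ ((T : ℤ) - 1) (E.γ 0) := by rw [E.τ_γ, add_zero]
    have hdist : E.dist (E.τ ((T : ℤ) - 1) b) (E.γ ((T : ℤ) - 1)) ≤
        Real.exp (E.c₁ * (d : ℝ) ^ σ) * E.dist b (E.γ 0) := by
      rw [hγ]
      refine le_trans (E.dist_τ_le _ _ _) (mul_le_mul_of_nonneg_right ?_ (E.dist_nonneg _ _))
      apply Real.exp_le_exp.mpr
      rw [habsT]
      exact mul_le_mul_of_nonneg_left (by linarith) E.c₁_nonneg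
    have hnn : (0 : ℝ) ≤ ((d : ℝ) + 2) ^ 3 * Real.exp (2 * (d : ℝ) ^ β) := by positivity
    calc v (E.τ ((T : ℤ) - 1) b)
        ≤ Real.exp (-(d : ℝ) ^ ν / 2) + ((d : ℝ) + 2) ^ 3 * Real.exp (2 * (d : ℝ) ^ β) *
            E.dist (E.τ ((T : ℤ) - 1) b) (E.γ ((T : ℤ) - 1)) := hu
      _ ≤ Real.exp (-(d : ℝ) ^ ν / 2) + ((d : ℝ) + 2) ^ 3 * Real.exp (2 * (d : ℝ) ^ β) *
            (Real.exp (E.c₁ * (d : ℝ) ^ σ) * E.dist b (E.γ 0)) := by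
          gcongr
      _ = Real.exp (-(d : ℝ) ^ ν / 2) + (((d : ℝ) + 2) ^ 3 * Real.exp (2 * (d : ℝ) ^ β) *
            Real.exp (E.c₁ * (d : ℝ) ^ σ)) * E.dist b (E.γ 0) := by ring
      _ ≤ Real.exp (-(d : ℝ) ^ ν / 2) + Real.exp (3 * (d : ℝ) ^ β) * E.dist b (E.γ 0) := by
          gcongr
          exact E.dist_nonneg _ _
  set G : ℝ := Real.exp (3 * (d : ℝ) ^ β) with hG
  set e₀ : ℝ := Real.exp (-(d : ℝ) ^ ν / 2) with he₀
  have hGpos : 0 < G := Real.exp_pos _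
  have he₀pos : 0 < e₀ := Real.exp_pos _
  have hG1 : 1 ≤ G := by
    rw [hG]; apply Real.one_le_exp; positivity
  have he₀1 : e₀ ≤ 1 := by
    rw [he₀]; apply Real.exp_le_one_iff.mpr
    have : 0 ≤ (d : ℝ) ^ ν := by positivity
    linarith
  have hlog2 : (0 : ℝ) ≤ Real.log 2 := Real.log_nonneg (by norm_num)
  have hlog3 : (0 : ℝ) ≤ Real.log 3 := Real.log_nonneg (by norm_num)
  have hβpos : (0 : ℝ) ≤ (d : ℝ) ^ β := by positivity
  have hd1σ : (d : ℝ) * (d : ℝ) ^ σ = (d : ℝ) ^ (1 + σ) := by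
    rw [Real.rpow_add hdpos, Real.rpow_one]
  -- every value is `≤ 3G`
  have hvall : ∀ b ∈ E.pts Zt, Real.log (v (E.τ ((T : ℤ) - 1) b)) ≤
      Real.log 3 + 3 * (d : ℝ) ^ β := by
    intro b hb
    have h' := hU' b hb
    have hdb : E.dist b (E.γ 0) ≤ 2 := E.dist_le_two _ _
    have h3 : v (E.τ ((T : ℤ) - 1) b) ≤ 3 * G := by
      have : G * E.dist b (E.γ 0) ≤ G * 2 := mul_le_mul_of_nonneg_left hdb hGpos.le
      linarith
    calc Real.log (v (E.τ ((T : ℤ) - 1) b)) ≤ Real.log (3 * G) :=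
          Real.log_le_log (hvpos' _ hb) h3
      _ = Real.log 3 + 3 * (d : ℝ) ^ β := by
          rw [Real.log_mul three_ne_zero hGpos.ne', hG, Real.log_exp]
  -- the sum over the points other than `a₀`
  have hrest : ∑ b ∈ (E.pts Zt).erase a₀, Real.log (v (E.τ ((T : ℤ) - 1) b)) ≤
      c * (Real.log 3 + 3 * (d : ℝ) ^ β) := by
    have h1 : ∑ b ∈ (E.pts Zt).erase a₀, Real.log (v (E.τ ((T : ℤ) - 1) b)) ≤
        ∑ _b ∈ (E.pts Zt).erase a₀, (Real.log 3 + 3 * (d : ℝ) ^ β) :=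
      Finset.sum_le_sum fun b hb => hvall b (Finset.mem_of_mem_erase hb)
    rw [Finset.sum_const, nsmul_eq_mul] at h1
    have h2 : ((((E.pts Zt).erase a₀).card : ℕ) : ℝ) ≤ c := by
      rw [hc_def]; exact_mod_cast Finset.card_erase_le
    have h3 : (0 : ℝ) ≤ Real.log 3 + 3 * (d : ℝ) ^ β := by positivity
    have h4 := mul_le_mul_of_nonneg_right h2 h3
    linarith
  have hsplit := Finset.add_sum_erase (E.pts Zt)
    (fun b => Real.log (v (E.τ ((T : ℤ) - 1) b))) ha₀
  -- `d h(Z'')`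
  have h5 : (d : ℝ) * E.ht (E.τV ((T : ℤ) - 1) Zt) ≤
      d * E.ht Zt + E.c₄ * (d : ℝ) ^ (1 + σ) * c := by
    have := mul_le_mul_of_nonneg_left hhtZ' hdpos.le
    rw [← hd1σ]
    linarith [this, show (d : ℝ) * (E.ht Zt + E.c₄ * (d : ℝ) ^ σ * c) =
      d * E.ht Zt + E.c₄ * (d * (d : ℝ) ^ σ) * c by ring]
  by_cases hsub : G * E.dist a₀ (E.γ 0) ≤ e₀
  · -- sub-case (i): absurd for `d` large
    have hv0 : Real.log (v (E.τ ((T : ℤ) - 1) a₀)) ≤ Real.log 2 + -(d : ℝ) ^ ν / 2 := by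
      have h' := hU' a₀ ha₀
      have h2 : v (E.τ ((T : ℤ) - 1) a₀) ≤ 2 * e₀ := by linarith
      calc Real.log (v (E.τ ((T : ℤ) - 1) a₀)) ≤ Real.log (2 * e₀) :=
            Real.log_le_log (hvpos' _ ha₀) h2
        _ = Real.log 2 + -(d : ℝ) ^ ν / 2 := by
            rw [Real.log_mul two_ne_zero he₀pos.ne', he₀, Real.log_exp]
    have hfin := hN₂ c (E.ht Zt) (by positivity) hdeg (E.ht_nonneg _) hht
    have h6 : c * (Real.log 3 + 3 * (d : ℝ) ^ β + E.c₇ * d + E.c₄ * (d : ℝ) ^ (1 + σ)) =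
        c * (Real.log 3 + 3 * (d : ℝ) ^ β) + E.c₇ * d * c + E.c₄ * (d : ℝ) ^ (1 + σ) * c := by
      ring
    linarith [hL, hsplit, hrest, hv0, h5, h6, hfin]
  · -- sub-case (ii): absurd for `D` large
    push Not at hsub
    have hda₀ : 0 < E.dist a₀ (E.γ 0) := E.dist_γ_pos Zt a₀ ha₀ 0
    have hv0 : Real.log (v (E.τ ((T : ℤ) - 1) a₀)) ≤
        Real.log 2 + 3 * (d : ℝ) ^ β + Real.log (E.dist a₀ (E.γ 0)) := by
      have h' := hU' a₀ ha₀
      have h2 : v (E.τ ((T : ℤ) - 1) a₀) ≤ 2 * (G * E.dist a₀ (E.γ 0)) := by linarith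
      calc Real.log (v (E.τ ((T : ℤ) - 1) a₀)) ≤ Real.log (2 * (G * E.dist a₀ (E.γ 0))) :=
            Real.log_le_log (hvpos' _ ha₀) h2
        _ = Real.log 2 + 3 * (d : ℝ) ^ β + Real.log (E.dist a₀ (E.γ 0)) := by
            rw [Real.log_mul two_ne_zero (mul_pos hGpos hda₀).ne',
              Real.log_mul hGpos.ne' hda₀.ne', hG, Real.log_exp]
            ring
    -- compare the powers of `d` with those of `D`
    have hβdD : (d : ℝ) ^ β ≤ (D : ℝ) ^ β := Real.rpow_le_rpow hdpos.le hdD' (by linarith)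
    have hσdD : (d : ℝ) ^ σ ≤ (D : ℝ) ^ σ := Real.rpow_le_rpow hdpos.le hdD' (by linarith)
    have hD1σ : (D : ℝ) * (D : ℝ) ^ σ = (D : ℝ) ^ (1 + σ) := by
      rw [Real.rpow_add hDpos, Real.rpow_one]
    have h7 : (d : ℝ) * E.ht (E.τV ((T : ℤ) - 1) Zt) ≤
        D * h + 2 * E.c₄ * (D : ℝ) ^ (1 + σ) * c := by
      have i1 : E.ht (E.τV ((T : ℤ) - 1) Zt) ≤ h + 2 * (E.c₄ * (D : ℝ) ^ σ * c) := by
        have : E.c₄ * (d : ℝ) ^ σ * c ≤ E.c₄ * (D : ℝ) ^ σ * c :=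
          mul_le_mul_of_nonneg_right (mul_le_mul_of_nonneg_left hσdD E.c₄_nonneg)
            (by positivity)
        linarith
      calc (d : ℝ) * E.ht (E.τV ((T : ℤ) - 1) Zt) ≤ D * E.ht (E.τV ((T : ℤ) - 1) Zt) :=
            mul_le_mul_of_nonneg_right hdD' (E.ht_nonneg _)
        _ ≤ D * (h + 2 * (E.c₄ * (D : ℝ) ^ σ * c)) := mul_le_mul_of_nonneg_left i1 hDpos.le
        _ = D * h + 2 * E.c₄ * (D * (D : ℝ) ^ σ) * c := by ring
        _ = D * h + 2 * E.c₄ * (D : ℝ) ^ (1 + σ) * c := by rw [hD1σ]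
    have h8 : E.c₇ * d * c ≤ E.c₇ * D * c :=
      mul_le_mul_of_nonneg_right (mul_le_mul_of_nonneg_left hdD' E.c₇_nonneg) (by positivity)
    have h9 : c * (Real.log 3 + 3 * (d : ℝ) ^ β) ≤ c * (Real.log 3 + 3 * (D : ℝ) ^ β) :=
      mul_le_mul_of_nonneg_left (by linarith) (by positivity)
    -- the powers of `D`
    set W : ℝ := (D : ℝ) ^ (ν + σ - 2) with hW
    set V : ℝ := (D : ℝ) ^ (ν - β + σ - 2) with hV
    have hVW : V * (D : ℝ) ^ β = W := by
      rw [hV, hW, ← Real.rpow_add hDpos]; ring_nf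
    have e1 : E.κ / 2 * V * (2 * (D : ℝ) ^ β * c + D * h) =
        E.κ * W * c + E.κ / 2 * V * (D * h) := by rw [← hVW]; ring
    have l1 : (D : ℝ) * h ≤ E.κ / 2 * V * (D * h) := by
      have h0 : 0 ≤ (D : ℝ) * h := by positivity
      have := mul_le_mul_of_nonneg_right hT1 h0
      linarith
    have r1 : c * (Real.log 3 + 3 * (D : ℝ) ^ β + E.c₇ * D + 2 * E.c₄ * (D : ℝ) ^ (1 + σ)) +
        (Real.log 2 + 2 * (D : ℝ) ^ β + E.c₁ * (D : ℝ) ^ σ) ≤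
        c * (Real.log 2 + Real.log 3 + 5 * (D : ℝ) ^ β + E.c₁ * (D : ℝ) ^ σ + E.c₇ * D +
          2 * E.c₄ * (D : ℝ) ^ (1 + σ)) := by
      have h0 : 0 ≤ Real.log 2 + 2 * (D : ℝ) ^ β + E.c₁ * (D : ℝ) ^ σ := by
        have := E.c₁_nonneg; positivity
      have hB := mul_le_mul_of_nonneg_right hcard1 h0
      linarith
    have r2 : c * (Real.log 2 + Real.log 3 + 5 * (D : ℝ) ^ β + E.c₁ * (D : ℝ) ^ σ + E.c₇ * D +
        2 * E.c₄ * (D : ℝ) ^ (1 + σ)) < c * (E.κ * W) :=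
      mul_lt_mul_of_pos_left hT2 (by positivity)
    linarith [hL, hsplit, hrest, hv0, hclose, hβdD, h7, h8, h9, e1, l1, r1, r2]

end Abstract

end Summit.Schanuel.Schanuel.Theorems.NguyenRoySharp

end
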